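import Literature.Analysis.FluidPDE.LocalTypeI
import Literature.Analysis.FluidPDE.LocalTypeIScaling
import Literature.Analysis.FluidPDE.CKNScalingExtras
import Literature.Analysis.FluidPDE.SuitableWeakInBallTools
import Literature.Analysis.FluidPDE.ESSLocalHolderBlowupLimit
import Literature.Analysis.FluidPDE.BlowupFarField
import HarnessLib

/-!
# HEREDITY of the extinct Type-I apex package under space translations
# (item `TerminalTrace.TypeITraceScarL3`, stmt-NavierStokesRegularity-18385; s25-5 / `target_packageH_translate`)

Seat ns-typeII-p3 g10 (cell ns-regularity-ideate), `--supports stmt-NavierStokesRegularity-18385` (helper).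
Line `annulus-dichotomy` (skeleton v3, sha16 a0af4d6cb8b072dd; nsreg-p2 g28, ROUND-26) works inside the
class of EXTINCT TYPE-I APICES: the package H(U, P, G, M, D₀, C) — `(U, P)` suitable in every parabolic ball
`Q(a)` at the space–time origin (Albritton–Barker's class), weak gradient `G` on every `Q(a)`,
`𝐈(Q(a)) ≤ M`, plain pressure bound `D(z₀, r) ≤ D₀` at apices `z₀.1 ≤ 0`, rate `‖U(s)‖ ≤ C/√(−s)` a.e.,
weakly null top trace.  The loud-dust stub applies quiet-shell exclusion to the SPACE TRANSLATES of a
survivor, which needs the package to be inherited by `(s, y) ↦ (U, P, G)(s, y + x)` with the SAME class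
(`target_packageH_translate` of the planner's `R26-targets.lean`).  This file proves it, clause by clause:

* `isSuitableWeakSolutionInBall_translate` — the one ingredient not in the tree by name: A–B's class at the
  origin is translation covariant (`Q_a((0,x)) ⊆ Q_{a+|x|}(0)` + `of_subset_zero` + `zoom` about `(0, x)`
  + `zoomOut a⁻¹` about the origin, whose composite IS the translation: `zoomOut_zoom_eq_translate`);
* `hasWeakSpatialGradientOn_translate`, `typeIBound_translate_le` (`𝐈` of the translate over `Q(a)` is
  `𝐈` over `Q_a((0,x))`), `cknD_translate_le`, `rate_translate`, `weakNull_translate` (test against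
  `φ(· − x)`), assembled in `apexPackage_translate`;
* `spread_translate` — SPREAD transfers (an exterior region of radius `R` for the translate contains the
  exterior region of radius `R + |x|` for `U`; a.e. transport `ae_restrict_comp_translate`);
* `isBackwardSingularPoint_translate_iff` — `(0, y)` is backward singular for the translate iff `(0, y + x)`
  is for `U`.

WHAT THIS IS NOT: not Stub QA / LOUD, not NS regularity — covariance bookkeeping for the apex class
[folklore; AlbrittonBarker2019 Def. 2.1 and §3 ("by translating in space-time and rescaling"); CKN1982 §2].
-/

noncomputable section

set_option linter.dupNamespace false

namespace Summit.NavierStokesRegularity.NavierStokesRegularity.Theorems.TypeITraceScarL3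

open MeasureTheory Set Function Filter Topology Metric
open Literature.Analysis.FluidPDE
open scoped NNReal ENNReal InnerProductSpace RealInnerProductSpace

section Translate

variable (x : EuclideanSpace ℝ (Fin 3))

/-- The unit zoom about `(0, x)` is the space translate (fields with values in a normed space). [folklore] -/
theorem one_smul_stPull_one_eq_translate {F : Type*} [NormedAddCommGroup F] [NormedSpace ℝ F]
    (ψ : ℝ → EuclideanSpace ℝ (Fin 3) → F) :
    (1 : ℝ) • stPull ((1 : ℝ) ^ 2) 1 0 x ψ = fun s y => ψ s (y + x) := by
  funext s y
  simp [stPull, add_comm]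

/-- The unit zoom about `(0, x)` is the space translate, `1² •` form. [folklore] -/
theorem one_sq_smul_stPull_one_eq_translate {F : Type*} [NormedAddCommGroup F] [NormedSpace ℝ F]
    (ψ : ℝ → EuclideanSpace ℝ (Fin 3) → F) :
    (1 : ℝ) ^ 2 • stPull ((1 : ℝ) ^ 2) 1 0 x ψ = fun s y => ψ s (y + x) := by
  funext s y
  simp [stPull, add_comm]

/-- The unit zoom about `(0, x)` is the space translate — gradient fields, `1² •` form (stated at the
concrete type so that the scalar action matches the covariance lemmas). [folklore] -/
theorem one_sq_smul_stPull_one_eq_translate_grad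
    (G : ℝ → EuclideanSpace ℝ (Fin 3) → EuclideanSpace ℝ (Fin 3) →L[ℝ] EuclideanSpace ℝ (Fin 3)) :
    (1 : ℝ) ^ 2 • stPull ((1 : ℝ) ^ 2) 1 0 x G = fun s y => G s (y + x) := by
  funext s y
  simp [stPull, add_comm]

/-- The unit zoom about `(0, x)` is the space translate — gradient fields, `(1·1) •` form. [folklore] -/
theorem one_mul_one_smul_stPull_one_eq_translate_grad
    (G : ℝ → EuclideanSpace ℝ (Fin 3) → EuclideanSpace ℝ (Fin 3) →L[ℝ] EuclideanSpace ℝ (Fin 3)) :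
    ((1 : ℝ) * 1) • stPull ((1 : ℝ) ^ 2) 1 0 x G = fun s y => G s (y + x) := by
  funext s y
  simp [stPull, add_comm]

/-- The unit space–time affine map about `(0, x)` sends the origin to `(0, x)`. [folklore] -/
theorem stAffine_one_apply_zero :
    stAffine ((1 : ℝ) ^ 2) 1 0 x (0 : ℝ × EuclideanSpace ℝ (Fin 3)) = ((0 : ℝ), x) := by
  simp [stAffine]

/-- The unit space–time affine map about `(0, x)` sends `(0, y)` to `(0, y + x)`. [folklore] -/
theorem stAffine_one_apply_top (y : EuclideanSpace ℝ (Fin 3)) :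
    stAffine ((1 : ℝ) ^ 2) 1 0 x (((0 : ℝ), y) : ℝ × EuclideanSpace ℝ (Fin 3)) = ((0 : ℝ), y + x) := by
  simp [stAffine, add_comm]

/-- The space translation pulls the backward cylinder `Q_r((0, x))` back to `Q_r(0)`. [folklore] -/
theorem stAffine_one_preimage_parabolicCylinder (r : ℝ) :
    stAffine ((1 : ℝ) ^ 2) 1 0 x ⁻¹'
        parabolicCylinder r (((0 : ℝ), x) : ℝ × EuclideanSpace ℝ (Fin 3)) =
      parabolicCylinder r (0 : ℝ × EuclideanSpace ℝ (Fin 3)) := by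
  have key := LocalTypeIScaling.stAffine_preimage_parabolicCylinder one_pos 0 x r
    (0 : ℝ × EuclideanSpace ℝ (Fin 3))
  rwa [one_mul, stAffine_one_apply_zero] at key

/-- `Q_a((0, x)) ⊆ Q_{a + |x|}(0)` for `a > 0`. [folklore] -/
theorem parabolicCylinder_top_subset_zero {a : ℝ} (ha : 0 < a) :
    parabolicCylinder a (((0 : ℝ), x) : ℝ × EuclideanSpace ℝ (Fin 3)) ⊆
      parabolicCylinder (a + ‖x‖) (0 : ℝ × EuclideanSpace ℝ (Fin 3)) := by
  rintro ⟨s, y⟩ hw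
  rw [mem_parabolicCylinder] at hw ⊢
  obtain ⟨⟨hs1, hs2⟩, hy⟩ := hw
  have hx : 0 ≤ ‖x‖ := norm_nonneg x
  refine ⟨⟨?_, by simpa using hs2⟩, ?_⟩
  · simp only [Prod.fst_zero, zero_sub] at hs1 ⊢
    nlinarith
  · simp only [Prod.snd_zero, dist_zero_right]
    have hd : dist y x < a := by simpa using hy
    calc ‖y‖ = dist y 0 := (dist_zero_right y).symm
      _ ≤ dist y x + dist x 0 := dist_triangle y x 0
      _ < a + ‖x‖ := by rw [dist_zero_right]; exact add_lt_add_of_lt_of_le hd le_rfl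

variable {x}

/-- **Zoom to the unit ball about `(0, x)` followed by the zoom-out by `a⁻¹` about the origin is the space
translation** (velocity weights `a`, `a⁻¹`). [folklore] -/
theorem zoomOut_zoom_eq_translate {F : Type*} [NormedAddCommGroup F] [NormedSpace ℝ F] {a : ℝ}
    (ha : a ≠ 0) (ψ : ℝ → EuclideanSpace ℝ (Fin 3) → F) :
    a⁻¹ • stPull (a⁻¹ ^ 2) a⁻¹ (0 : ℝ) (0 : EuclideanSpace ℝ (Fin 3))
        (a • stPull (a ^ 2) a (0 : ℝ) x ψ) = fun s y => ψ s (y + x) := by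
  funext s y
  have h1 : (0 : ℝ) + a ^ 2 * (0 + a⁻¹ ^ 2 * s) = s := by
    rw [zero_add, zero_add, ← mul_assoc, ← mul_pow, mul_inv_cancel₀ ha, one_pow, one_mul]
  have h2 : x + a • ((0 : EuclideanSpace ℝ (Fin 3)) + a⁻¹ • y) = y + x := by
    rw [zero_add, smul_smul, mul_inv_cancel₀ ha, one_smul, add_comm]
  show a⁻¹ • (a • ψ (0 + a ^ 2 * (0 + a⁻¹ ^ 2 * s)) (x + a • (0 + a⁻¹ • y))) = ψ s (y + x)
  rw [h1, h2, smul_smul, inv_mul_cancel₀ ha, one_smul]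

/-- Same with the pressure/gradient weights `a²`, `a⁻²`. [folklore] -/
theorem zoomOut_zoom_eq_translate_sq {F : Type*} [NormedAddCommGroup F] [NormedSpace ℝ F] {a : ℝ}
    (ha : a ≠ 0) (ψ : ℝ → EuclideanSpace ℝ (Fin 3) → F) :
    a⁻¹ ^ 2 • stPull (a⁻¹ ^ 2) a⁻¹ (0 : ℝ) (0 : EuclideanSpace ℝ (Fin 3))
        (a ^ 2 • stPull (a ^ 2) a (0 : ℝ) x ψ) = fun s y => ψ s (y + x) := by
  funext s y
  have h1 : (0 : ℝ) + a ^ 2 * (0 + a⁻¹ ^ 2 * s) = s := by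
    rw [zero_add, zero_add, ← mul_assoc, ← mul_pow, mul_inv_cancel₀ ha, one_pow, one_mul]
  have h2 : x + a • ((0 : EuclideanSpace ℝ (Fin 3)) + a⁻¹ • y) = y + x := by
    rw [zero_add, smul_smul, mul_inv_cancel₀ ha, one_smul, add_comm]
  have h3 : a⁻¹ ^ 2 * a ^ 2 = 1 := by rw [← mul_pow, inv_mul_cancel₀ ha, one_pow]
  show a⁻¹ ^ 2 • (a ^ 2 • ψ (0 + a ^ 2 * (0 + a⁻¹ ^ 2 * s)) (x + a • (0 + a⁻¹ • y))) = ψ s (y + x)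
  rw [h1, h2, smul_smul, h3, one_smul]

variable (x)

/-- **Albritton–Barker's class is translation covariant at the top time**: if `(U, P)` is a suitable weak
solution in every parabolic ball `Q(a)` at the origin, so is its space translate `(s, y) ↦ U(s, y + x)`
(restrict to `Q_a((0,x)) ⊆ Q_{a+|x|}(0)`, zoom to the unit ball about `(0, x)`, zoom out by `a⁻¹` about
the origin). [cite: AlbrittonBarker2019, Def. 2.1 and §3 ("by translating in space-time and rescaling")] -/
theorem isSuitableWeakSolutionInBall_translate
    {U : ℝ → EuclideanSpace ℝ (Fin 3) → EuclideanSpace ℝ (Fin 3)}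
    {P : ℝ → EuclideanSpace ℝ (Fin 3) → ℝ}
    (hsw : ∀ a : ℝ, 0 < a →
      IsSuitableWeakSolutionInBall a (0 : ℝ × EuclideanSpace ℝ (Fin 3)) U P) :
    ∀ a : ℝ, 0 < a →
      IsSuitableWeakSolutionInBall a (0 : ℝ × EuclideanSpace ℝ (Fin 3))
        (fun s y => U s (y + x)) (fun s y => P s (y + x)) := by
  intro a ha
  have hax : 0 < a + ‖x‖ := add_pos_of_pos_of_nonneg ha (norm_nonneg x)
  have h1 : IsSuitableWeakSolutionInBall a (((0 : ℝ), x) : ℝ × EuclideanSpace ℝ (Fin 3)) U P :=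
    (hsw _ hax).of_subset_zero ha (parabolicCylinder_top_subset_zero x ha)
  have h2 := (h1.zoom ha).zoomOut (c := a⁻¹) (inv_pos.2 ha)
  dsimp only at h2
  rw [zoomOut_zoom_eq_translate ha.ne', zoomOut_zoom_eq_translate_sq ha.ne', one_div, inv_inv] at h2
  exact h2

/-- **Weak spatial gradients are translation covariant** on the backward cylinders at the origin.
[folklore] -/
theorem hasWeakSpatialGradientOn_translate
    {U : ℝ → EuclideanSpace ℝ (Fin 3) → EuclideanSpace ℝ (Fin 3)}
    {G : ℝ → EuclideanSpace ℝ (Fin 3) → EuclideanSpace ℝ (Fin 3) →L[ℝ] EuclideanSpace ℝ (Fin 3)}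
    (hG : ∀ a : ℝ, 0 < a →
      HasWeakSpatialGradientOn (parabolicCylinderOpens a (0 : ℝ × EuclideanSpace ℝ (Fin 3))) U G) :
    ∀ a : ℝ, 0 < a →
      HasWeakSpatialGradientOn (parabolicCylinderOpens a (0 : ℝ × EuclideanSpace ℝ (Fin 3)))
        (fun s y => U s (y + x)) (fun s y => G s (y + x)) := by
  intro a ha
  have hax : 0 < a + ‖x‖ := add_pos_of_pos_of_nonneg ha (norm_nonneg x)
  have hle : parabolicCylinderOpens a (((0 : ℝ), x) : ℝ × EuclideanSpace ℝ (Fin 3)) ≤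
      parabolicCylinderOpens (a + ‖x‖) (0 : ℝ × EuclideanSpace ℝ (Fin 3)) :=
    fun w hw => parabolicCylinder_top_subset_zero x ha hw
  have h1 := ((hG _ hax).mono hle).stRescale 1 (β := (1 : ℝ) ^ 2) (γ := 1) (by norm_num) one_pos 0 x
  have hpre : stPreimage ((1 : ℝ) ^ 2) 1 0 x
      (parabolicCylinderOpens a (((0 : ℝ), x) : ℝ × EuclideanSpace ℝ (Fin 3))) =
      parabolicCylinderOpens a (0 : ℝ × EuclideanSpace ℝ (Fin 3)) :=
    TopologicalSpace.Opens.ext (stAffine_one_preimage_parabolicCylinder x a)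
  rw [hpre, one_smul_stPull_one_eq_translate, one_mul_one_smul_stPull_one_eq_translate_grad] at h1
  exact h1

/-- **`𝐈` is translation covariant**: the Albritton–Barker quantity of the translate over `Q(a)` is that of
`(U, P, G)` over `Q_a((0, x)) ⊆ Q_{a+|x|}(0)`, hence `≤ M` under the package bound.
[cite: AlbrittonBarker2019, §3 ("by translating in space-time and rescaling")] -/
theorem typeIBound_translate_le
    {U : ℝ → EuclideanSpace ℝ (Fin 3) → EuclideanSpace ℝ (Fin 3)}
    {P : ℝ → EuclideanSpace ℝ (Fin 3) → ℝ}
    {G : ℝ → EuclideanSpace ℝ (Fin 3) → EuclideanSpace ℝ (Fin 3) →L[ℝ] EuclideanSpace ℝ (Fin 3)}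
    {M : ℝ≥0}
    (hI : ∀ a : ℝ, 0 < a →
      typeIBound (parabolicCylinder a (0 : ℝ × EuclideanSpace ℝ (Fin 3))) U P G ≤ M) :
    ∀ a : ℝ, 0 < a →
      typeIBound (parabolicCylinder a (0 : ℝ × EuclideanSpace ℝ (Fin 3)))
        (fun s y => U s (y + x)) (fun s y => P s (y + x)) (fun s y => G s (y + x)) ≤ M := by
  intro a ha
  have hax : 0 < a + ‖x‖ := add_pos_of_pos_of_nonneg ha (norm_nonneg x)
  have key := typeIBound_nsZoom one_pos 0 x
    (parabolicCylinder a (((0 : ℝ), x) : ℝ × EuclideanSpace ℝ (Fin 3))) U P G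
  rw [stAffine_one_preimage_parabolicCylinder, one_smul_stPull_one_eq_translate,
    one_sq_smul_stPull_one_eq_translate, one_sq_smul_stPull_one_eq_translate_grad] at key
  rw [key]
  exact (typeIBound_mono (parabolicCylinder_top_subset_zero x ha)).trans (hI _ hax)

/-- **The plain pressure functional is translation covariant**: `D(P(·, · + x); z₀, r) = D(P; z₀ + (0,x), r)`,
so the apex bound `D ≤ D₀` for apices `z₀.1 ≤ 0` is inherited. [folklore] -/
theorem cknD_translate_le
    {P : ℝ → EuclideanSpace ℝ (Fin 3) → ℝ} {D₀ : ℝ≥0}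
    (hD : ∀ z₀ : ℝ × EuclideanSpace ℝ (Fin 3), z₀.1 ≤ 0 → ∀ r : ℝ, 0 < r → cknD r z₀ P ≤ D₀) :
    ∀ z₀ : ℝ × EuclideanSpace ℝ (Fin 3), z₀.1 ≤ 0 → ∀ r : ℝ, 0 < r →
      cknD r z₀ (fun s y => P s (y + x)) ≤ D₀ := by
  intro z₀ hz₀ r hr
  have key := cknD_nsZoom one_pos hr 0 x z₀ P
  rw [one_sq_smul_stPull_one_eq_translate, one_mul] at key
  rw [key]
  refine hD _ ?_ r hr
  simpa [stAffine] using hz₀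

/-- **The Type-I rate is translation invariant** (Lebesgue measure is). [folklore] -/
theorem rate_translate
    {U : ℝ → EuclideanSpace ℝ (Fin 3) → EuclideanSpace ℝ (Fin 3)} {C : ℝ}
    (hrate : ∀ s : ℝ, s < 0 →
      ∀ᵐ y : EuclideanSpace ℝ (Fin 3), ‖U s y‖ ≤ C / Real.sqrt (-s)) :
    ∀ s : ℝ, s < 0 →
      ∀ᵐ y : EuclideanSpace ℝ (Fin 3), ‖(fun s y => U s (y + x)) s y‖ ≤ C / Real.sqrt (-s) :=
  fun s hs => (measurePreserving_add_right (volume : Measure (EuclideanSpace ℝ (Fin 3))) x)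
    |>.quasiMeasurePreserving.ae (hrate s hs)

/-- **Weak nullity at the top is translation invariant**: test the translate against `φ` by testing `U`
against `φ(· − x)`. [folklore] -/
theorem weakNull_translate
    {U : ℝ → EuclideanSpace ℝ (Fin 3) → EuclideanSpace ℝ (Fin 3)}
    (htop : ∀ φ : EuclideanSpace ℝ (Fin 3) → EuclideanSpace ℝ (Fin 3),
      ContDiff ℝ (⊤ : ℕ∞) φ →
      HasCompactSupport φ → ∀ ε : ℝ, 0 < ε →
      ∃ s₀ : ℝ, s₀ < 0 ∧ ∀ᵐ s ∂(volume.restrict (Ioo s₀ 0)), |∫ y, ⟪U s y, φ y⟫| ≤ ε) :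
    ∀ φ : EuclideanSpace ℝ (Fin 3) → EuclideanSpace ℝ (Fin 3),
      ContDiff ℝ (⊤ : ℕ∞) φ →
      HasCompactSupport φ → ∀ ε : ℝ, 0 < ε →
      ∃ s₀ : ℝ, s₀ < 0 ∧ ∀ᵐ s ∂(volume.restrict (Ioo s₀ 0)),
        |∫ y, ⟪(fun s y => U s (y + x)) s y, φ y⟫| ≤ ε := by
  intro φ hφ hφc ε hε
  have hφ' : ContDiff ℝ (⊤ : ℕ∞) (fun y : EuclideanSpace ℝ (Fin 3) => φ (y - x)) :=
    hφ.comp (contDiff_id.sub contDiff_const)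
  have hφc' : HasCompactSupport (fun y : EuclideanSpace ℝ (Fin 3) => φ (y - x)) := by
    have h := hφc.comp_homeomorph (Homeomorph.subRight x)
    convert h using 1
    funext y
    simp
  obtain ⟨s₀, hs₀, h⟩ := htop _ hφ' hφc' ε hε
  refine ⟨s₀, hs₀, ?_⟩
  filter_upwards [h] with s hs
  have e : (∫ y, ⟪U s (y + x), φ y⟫) = ∫ y, ⟪U s y, φ (y - x)⟫ := by
    rw [← integral_add_right_eq_self (fun y => ⟪U s y, φ (y - x)⟫) x]
    simp only [add_sub_cancel_right]
  simpa only [e] using hs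

/-- Transport of an a.e. statement on a restricted product Lebesgue measure along the space translation
`(s, y) ↦ (s, y + x)` (a measure-preserving map of `ℝ × ℝ³`). [folklore] -/
theorem ae_restrict_comp_translate {A : Set (ℝ × EuclideanSpace ℝ (Fin 3))} (hA : MeasurableSet A)
    {p : ℝ × EuclideanSpace ℝ (Fin 3) → Prop} (h : ∀ᵐ z ∂(volume.restrict A), p z) :
    ∀ᵐ z ∂(volume.restrict
      ((fun z : ℝ × EuclideanSpace ℝ (Fin 3) => (z.1, z.2 + x)) ⁻¹' A)), p (z.1, z.2 + x) := by
  set T : ℝ × EuclideanSpace ℝ (Fin 3) → ℝ × EuclideanSpace ℝ (Fin 3) := fun z => (z.1, z.2 + x) with hT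
  have hTm : Measurable T := measurable_fst.prodMk (measurable_snd.add_const x)
  have hmp : MeasurePreserving T (volume : Measure (ℝ × EuclideanSpace ℝ (Fin 3)))
      (volume : Measure (ℝ × EuclideanSpace ℝ (Fin 3))) := by
    have h1 := (MeasurePreserving.id (volume : Measure ℝ)).prod
      (measurePreserving_add_right (volume : Measure (EuclideanSpace ℝ (Fin 3))) x)
    exact h1
  have h' : ∀ᵐ z ∂(volume : Measure (ℝ × EuclideanSpace ℝ (Fin 3))), z ∈ A → p z :=
    (ae_restrict_iff' hA).1 h
  have h'' : ∀ᵐ z ∂(volume : Measure (ℝ × EuclideanSpace ℝ (Fin 3))), T z ∈ A → p (T z) :=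
    hmp.quasiMeasurePreserving.ae h'
  rw [ae_restrict_iff' (hA.preimage hTm)]
  exact h''

/-- **SPREAD transfers to the translate**: if `U` is essentially unbounded in every exterior late region,
so is `(s, y) ↦ U(s, y + x)` (an exterior region of radius `R` for the translate contains the exterior
region of radius `R + |x|` for `U`). [folklore] -/
theorem spread_translate
    {U : ℝ → EuclideanSpace ℝ (Fin 3) → EuclideanSpace ℝ (Fin 3)}
    (hspread : ∀ δ : ℝ, 0 < δ → ∀ R K : ℝ,
      ¬ (∀ᵐ z ∂(volume.restrict
        (Ioo (-δ) 0 ×ˢ (closedBall (0 : EuclideanSpace ℝ (Fin 3)) R)ᶜ)), ‖U z.1 z.2‖ ≤ K)) :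
    ∀ δ : ℝ, 0 < δ → ∀ R K : ℝ,
      ¬ (∀ᵐ z ∂(volume.restrict
        (Ioo (-δ) 0 ×ˢ (closedBall (0 : EuclideanSpace ℝ (Fin 3)) R)ᶜ)),
          ‖(fun s y => U s (y + x)) z.1 z.2‖ ≤ K) := by
  intro δ hδ R K hb
  apply hspread δ hδ (R + ‖x‖) K
  -- transport the bound back along `(s, y) ↦ (s, y - x)`
  have hA : MeasurableSet (Ioo (-δ) 0 ×ˢ (closedBall (0 : EuclideanSpace ℝ (Fin 3)) R)ᶜ) :=
    measurableSet_Ioo.prod measurableSet_closedBall.compl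
  have h1 := ae_restrict_comp_translate (-x) hA hb
  have hsub : Ioo (-δ) 0 ×ˢ (closedBall (0 : EuclideanSpace ℝ (Fin 3)) (R + ‖x‖))ᶜ ⊆
      (fun z : ℝ × EuclideanSpace ℝ (Fin 3) => (z.1, z.2 + -x)) ⁻¹'
        (Ioo (-δ) 0 ×ˢ (closedBall (0 : EuclideanSpace ℝ (Fin 3)) R)ᶜ) := by
    rintro ⟨s, y⟩ ⟨hs, hy⟩
    refine ⟨hs, ?_⟩
    simp only [mem_compl_iff, mem_closedBall, dist_zero_right, not_le] at hy ⊢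
    have htri : ‖y‖ ≤ ‖y + -x‖ + ‖x‖ := by
      calc ‖y‖ = ‖(y + -x) + x‖ := by rw [neg_add_cancel_right]
        _ ≤ ‖y + -x‖ + ‖x‖ := norm_add_le _ _
    linarith
  have h2 := ae_restrict_of_ae_restrict_of_subset hsub h1
  filter_upwards [h2] with z hz
  simpa using hz

/-- **Backward singular points move with the translation**: `(0, y)` is backward singular for the translate
iff `(0, y + x)` is backward singular for `U`. [folklore] -/
theorem isBackwardSingularPoint_translate_iff
    (U : ℝ → EuclideanSpace ℝ (Fin 3) → EuclideanSpace ℝ (Fin 3)) (y : EuclideanSpace ℝ (Fin 3)) :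
    IsBackwardSingularPoint (fun s y => U s (y + x)) ((0 : ℝ), y) ↔
      IsBackwardSingularPoint U ((0 : ℝ), y + x) := by
  have key : ∀ r : ℝ,
      eLpNorm (uncurry (fun s y => U s (y + x))) ∞
          (volume.restrict (parabolicCylinder r (((0 : ℝ), y) : ℝ × EuclideanSpace ℝ (Fin 3)))) =
        eLpNorm (uncurry U) ∞
          (volume.restrict (parabolicCylinder r (((0 : ℝ), y + x) : ℝ × EuclideanSpace ℝ (Fin 3)))) := by
    intro r
    have h := eLpNorm_top_nsZoom one_pos 0 x r (((0 : ℝ), y) : ℝ × EuclideanSpace ℝ (Fin 3)) U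
    rwa [one_smul_stPull_one_eq_translate, ENNReal.ofReal_one, one_mul, one_mul,
      stAffine_one_apply_top] at h
  simp only [IsBackwardSingularPoint, key]

/-- The same at the origin: `0` is backward singular for the translate iff `(0, x)` is for `U`. [folklore] -/
theorem isBackwardSingularPoint_translate_zero_iff
    (U : ℝ → EuclideanSpace ℝ (Fin 3) → EuclideanSpace ℝ (Fin 3)) :
    IsBackwardSingularPoint (fun s y => U s (y + x)) (0 : ℝ × EuclideanSpace ℝ (Fin 3)) ↔
      IsBackwardSingularPoint U ((0 : ℝ), x) := by
  have h := isBackwardSingularPoint_translate_iff x U 0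
  rw [zero_add] at h
  exact h

/-- **HEREDITY of the apex package (s25-5; `target_packageH_translate` with the six clauses spelled out).**
If `(U, P, G)` carries the extinct Type-I apex package of class `(M, D₀, C)` at the origin — suitable in
every `Q(a)`, weak gradient on every `Q(a)`, `𝐈(Q(a)) ≤ M`, `D(z₀, r) ≤ D₀` for `z₀.1 ≤ 0`, rate
`C/√(−s)`, weakly null top — then so does its space translate `(s, y) ↦ (U, P, G)(s, y + x)` at every
`x ∈ ℝ³`, with the SAME class; and SPREAD transfers.
[cite: AlbrittonBarker2019, §3 ("by translating in space-time and rescaling")] -/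
theorem apexPackage_translate
    {U : ℝ → EuclideanSpace ℝ (Fin 3) → EuclideanSpace ℝ (Fin 3)}
    {P : ℝ → EuclideanSpace ℝ (Fin 3) → ℝ}
    {G : ℝ → EuclideanSpace ℝ (Fin 3) → EuclideanSpace ℝ (Fin 3) →L[ℝ] EuclideanSpace ℝ (Fin 3)}
    {M D₀ : ℝ≥0} {C : ℝ}
    (hsw : ∀ a : ℝ, 0 < a →
      IsSuitableWeakSolutionInBall a (0 : ℝ × EuclideanSpace ℝ (Fin 3)) U P)
    (hG : ∀ a : ℝ, 0 < a →
      HasWeakSpatialGradientOn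
        (parabolicCylinderOpens a (0 : ℝ × EuclideanSpace ℝ (Fin 3))) U G)
    (hI : ∀ a : ℝ, 0 < a →
      typeIBound (parabolicCylinder a (0 : ℝ × EuclideanSpace ℝ (Fin 3))) U P G ≤ M)
    (hD : ∀ z₀ : ℝ × EuclideanSpace ℝ (Fin 3), z₀.1 ≤ 0 →
      ∀ r : ℝ, 0 < r → cknD r z₀ P ≤ D₀)
    (hrate : ∀ s : ℝ, s < 0 →
      ∀ᵐ y : EuclideanSpace ℝ (Fin 3), ‖U s y‖ ≤ C / Real.sqrt (-s))
    (htop : ∀ φ : EuclideanSpace ℝ (Fin 3) → EuclideanSpace ℝ (Fin 3),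
      ContDiff ℝ (⊤ : ℕ∞) φ →
      HasCompactSupport φ → ∀ ε : ℝ, 0 < ε →
      ∃ s₀ : ℝ, s₀ < 0 ∧ ∀ᵐ s ∂(volume.restrict (Ioo s₀ 0)), |∫ y, ⟪U s y, φ y⟫| ≤ ε) :
    (∀ a : ℝ, 0 < a →
      IsSuitableWeakSolutionInBall a (0 : ℝ × EuclideanSpace ℝ (Fin 3))
        (fun s y => U s (y + x)) (fun s y => P s (y + x))) ∧
    (∀ a : ℝ, 0 < a →
      HasWeakSpatialGradientOn
        (parabolicCylinderOpens a (0 : ℝ × EuclideanSpace ℝ (Fin 3)))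
        (fun s y => U s (y + x)) (fun s y => G s (y + x))) ∧
    (∀ a : ℝ, 0 < a →
      typeIBound (parabolicCylinder a (0 : ℝ × EuclideanSpace ℝ (Fin 3)))
        (fun s y => U s (y + x)) (fun s y => P s (y + x)) (fun s y => G s (y + x)) ≤ M) ∧
    (∀ z₀ : ℝ × EuclideanSpace ℝ (Fin 3), z₀.1 ≤ 0 →
      ∀ r : ℝ, 0 < r → cknD r z₀ (fun s y => P s (y + x)) ≤ D₀) ∧
    (∀ s : ℝ, s < 0 →
      ∀ᵐ y : EuclideanSpace ℝ (Fin 3), ‖(fun s y => U s (y + x)) s y‖ ≤ C / Real.sqrt (-s)) ∧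
    (∀ φ : EuclideanSpace ℝ (Fin 3) → EuclideanSpace ℝ (Fin 3),
      ContDiff ℝ (⊤ : ℕ∞) φ →
      HasCompactSupport φ → ∀ ε : ℝ, 0 < ε →
      ∃ s₀ : ℝ, s₀ < 0 ∧ ∀ᵐ s ∂(volume.restrict (Ioo s₀ 0)),
        |∫ y, ⟪(fun s y => U s (y + x)) s y, φ y⟫| ≤ ε) :=
  ⟨isSuitableWeakSolutionInBall_translate x hsw, hasWeakSpatialGradientOn_translate x hG,
    typeIBound_translate_le x hI, cknD_translate_le x hD, rate_translate x hrate,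
    weakNull_translate x htop⟩

end Translate

end Summit.NavierStokesRegularity.NavierStokesRegularity.Theorems.TypeITraceScarL3

end
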